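import Summits.Langlands.Langlands.Theses.CyclicLayerPeeling

/-!
# Route CyclicLayerPeeling — Assembly

The assembly item (stmt-Langlands-27864) of the child route `CyclicLayerPeeling` (decomp-langlands lens-4 gen 23; `--refines route-Langlands-RootDecomp1:AvatarDescent`, edge split, depth 1) for
AvDesc = `RootDecomp1.AvatarDescent` (stmt-Langlands-29149):
`PrimeCyclicLayerDescent → AnabelianLayerDescent → SelfTwistedLayerDescent → CyclicBaseChangeBelow → RootDecomp1.AvatarDescent`.

This is literally the type of the route file's sorry-free deciding theorem `Summit.Langlands.Langlands.Theses.CyclicLayerPeeling.closes`.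
Nothing here proves `Langlands` (nor the parent piece): the assembly records only that the four binders of the route (CPD, ANAB, SELF and the below-rank base-change support), taken together,
imply the parent piece by name.
-/

set_option linter.dupNamespace false -- project-wide option (lakefile weak.linter.dupNamespace); `Summit.Langlands.Langlands` is the mandated namespace

namespace Summit.Langlands.Langlands.Theorems

/-- **Assembly of route CyclicLayerPeeling** (stmt-Langlands-27864): `PrimeCyclicLayerDescent → AnabelianLayerDescent → SelfTwistedLayerDescent → CyclicBaseChangeBelow → RootDecomp1.AvatarDescent`.
Proof: unfold `Assembly` and apply the route's deciding theorem `Theses.CyclicLayerPeeling.closes`. -/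
theorem cyclicLayerPeeling_assembly_proof :
    Summit.Langlands.Langlands.Theses.CyclicLayerPeeling.Assembly := by
  unfold Summit.Langlands.Langlands.Theses.CyclicLayerPeeling.Assembly
  exact Summit.Langlands.Langlands.Theses.CyclicLayerPeeling.closes

end Summit.Langlands.Langlands.Theorems
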